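import Summits.QuantumFields.YangMills.Theorems.NPointIsotropy.Negative.ModelBlindFalse

/-!
# Crux-triage r1 / triager 3 (stmt-QuantumFields-11686, `PencilRigidity.NPointIsotropy`):
# the first lemma `AngularBandLimit` of card `entire-angle-band-limit` is false as typed

The definitions `IsPlanarRotation`, `EightFrameRP`, `AngularBandLimit` below are copied VERBATIM from
`Summits/QuantumFields/YangMills/Cruxes/NPointIsotropy/SketchIdeator3.lean` (ideator 3, round 1); only the
namespace differs, and the Sketch's local notation `E` (for `EuclideanSpace ℝ (Fin 4)`) is written as the tree's reducible
`abbrev E4 := EuclideanSpace ℝ (Fin 4)`; the two statements are the same term up to unfolding that abbreviation (using `E4`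
keeps instance paths identical with the imported `Negative/` files). `not_AngularBandLimit` refutes the lemma with the standing disprover's LANDED junk family
(`Theorems/NPointIsotropy/Negative/JunkFamily.lean`, `ModelBlindFalse.lean`): `junk` satisfies E0', E3,
translation invariance, quarter-turn invariance and reflection positivity in all eight planar frames, yet
`θ ↦ 𝔖₄(R_θ · F₀)` (bumps at `0, 10e₃, 10e₂, 10e₀`) is positive at `θ = 0` and vanishes for every
`θ ∈ (1/2, 1)` — so it is not a trigonometric polynomial in `e^{4iθ}` (a finite exponential sum vanishing on
an interval vanishes identically, by the identity theorem for real-analytic functions).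

MORAL for the line: the band-limit lever can only hold for test functions supported on PLANAR-GENERIC
configurations (as the sibling card `entire-complex-angle-bandlimit` types it: `J` vanishes there), and the
passage generic ⇒ all of `⁰𝒮` needs the regularity clause of `ModelBlindFalse` (no singular part of `𝔖ₙ` on
the frame-invisible set), i.e. the lattice clause of `W₁` or an added `L¹_loc` hypothesis.
-/

noncomputable section

attribute [-instance] SimplexCategory.instFintypeToTypeOrderHomFinHAddNatLenOfNat

namespace Summit.QuantumFields.YangMills.Theorems.NPointIsotropy.Negative.Triage3

open scoped BigOperators ComplexConjugate InnerProductSpace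
open MeasureTheory Filter Topology
open Literature.MathematicalPhysics.QuantumLattice Literature.MathematicalPhysics.AQFT
  Literature.MathematicalPhysics.QuantumFieldTheory
open Summit.QuantumFields.YangMills.Theorems.NPointIsotropy.Negative

/-! ## §0 The statements under test (verbatim from `SketchIdeator3.lean`) -/

/-- A linear isometry `R` of `ℝ⁴` is "the planar rotation by `θ`" of the `(x₀,x₁)`-plane. -/
def IsPlanarRotation (R : E4 ≃ₗᵢ[ℝ] E4) (θ : ℝ) : Prop :=
  LinearMap.det (R.toLinearEquiv : E4 →ₗ[ℝ] E4) = 1 ∧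
    R (EuclideanSpace.single 2 1) = EuclideanSpace.single 2 1 ∧
    R (EuclideanSpace.single 3 1) = EuclideanSpace.single 3 1 ∧
    R (EuclideanSpace.single 0 1) =
      Real.cos θ • EuclideanSpace.single 0 1 + Real.sin θ • EuclideanSpace.single 1 1

/-- RP in pull-back form for the eight planar frames `R e₀ ∈ {±e₀, ±e₁, (±e₀ ± e₁)/√2}`
(verbatim the crux's hypothesis shape). -/
def EightFrameRP (S : SchwingerFamily E4) : Prop :=
  ∀ (R : E4 ≃ₗᵢ[ℝ] E4) (a b : ℝ), a ^ 2 + b ^ 2 = 1 → (a = 0 ∨ b = 0 ∨ a ^ 2 = b ^ 2) →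
    R (EuclideanSpace.single 0 1) = a • EuclideanSpace.single 0 1 + b • EuclideanSpace.single 1 1 →
    (SchwingerFamily.toLabelled (fun n => (S n).comp (linActMulti R))).IsReflectionPositive

/-- **First lemma of card `entire-angle-band-limit` (n-point form)** — verbatim. -/
def AngularBandLimit : Prop :=
  ∀ (S : SchwingerFamily E4), S.toLabelled.HasLinearGrowth → S.toLabelled.IsSymmetric →
    (∀ (n : ℕ) (a : E4) (F : SchwartzMap (Fin n → E4) ℂ), IsOffDiagonal F →
      S n (translateMulti a F) = S n F) →
    (∀ (R : E4 ≃ₗᵢ[ℝ] E4), IsPlanarRotation R (Real.pi / 2) →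
      ∀ (n : ℕ) (F : SchwartzMap (Fin n → E4) ℂ), IsOffDiagonal F → S n (linActMulti R F) = S n F) →
    EightFrameRP S →
    ∃ C : ℝ, ∀ (n : ℕ) (F : SchwartzMap (Fin n → E4) ℂ), IsOffDiagonal F →
      ∃ (N : ℕ) (c : ℤ → ℂ), (N : ℝ) ≤ C * (n + 1) ∧
        ∀ (R : E4 ≃ₗᵢ[ℝ] E4) (θ : ℝ), IsPlanarRotation R θ →
          S n (linActMulti R F) =
            ∑ k ∈ Finset.Icc (-(N : ℤ)) N, c k * Complex.exp (4 * (k : ℂ) * (θ : ℂ) * Complex.I)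

/-! ## §1 A one-parameter family of planar rotations `R_θ : e₀ ↦ cos θ e₀ + sin θ e₁` -/

/-- Coordinates against the axis vectors. -/
theorem inner_single_one (z : E4) (i : Fin 4) : ⟪z, EuclideanSpace.single i (1 : ℝ)⟫_ℝ = z i := by
  simp [EuclideanSpace.inner_single_right]

/-- The unit vector `u_θ = cos θ e₀ + sin θ e₁`. -/
def uθ (θ : ℝ) : E4 := Real.cos θ • e 0 + Real.sin θ • e 1

/-- Coordinates of `u_θ`. -/
theorem uθ_apply (θ : ℝ) (j : Fin 4) :
    uθ θ j = if j = 0 then Real.cos θ else if j = 1 then Real.sin θ else 0 := by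
  fin_cases j <;> simp [uθ, e]

/-- `‖u_θ‖ = 1`. -/
theorem norm_uθ (θ : ℝ) : ‖uθ θ‖ = 1 := by
  have h : ‖uθ θ‖ ^ 2 = 1 := by
    rw [EuclideanSpace.norm_sq_eq]
    simp [uθ_apply, Fin.sum_univ_four, Real.cos_sq_add_sin_sq]
  nlinarith [norm_nonneg (uθ θ)]

/-- Mirror exchanging `e₀` and `u_θ`. -/
def ρθ (θ : ℝ) : E4 ≃ₗᵢ[ℝ] E4 := (ℝ ∙ (e 0 - uθ θ))ᗮ.reflection

/-- **The rotation** `R_θ = ρ_θ ∘ ρ₁` of the `(e₀,e₁)`-plane: `e₀ ↦ u_θ`, fixing `e₂, e₃`. -/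
def Rθ (θ : ℝ) : E4 ≃ₗᵢ[ℝ] E4 := ρ₁.trans (ρθ θ)

/-- `ρ_θ e₀ = u_θ`. -/
theorem ρθ_e0 (θ : ℝ) : ρθ θ (e 0) = uθ θ := Submodule.reflection_sub (by rw [norm_e, norm_uθ])

/-- `ρ_θ e₂ = e₂`. -/
theorem ρθ_e2 (θ : ℝ) : ρθ θ (e 2) = e 2 :=
  reflection_fix (by simp [uθ, inner_sub_left, inner_add_left, real_inner_smul_left, inner_e_e])

/-- `ρ_θ e₃ = e₃`. -/
theorem ρθ_e3 (θ : ℝ) : ρθ θ (e 3) = e 3 :=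
  reflection_fix (by simp [uθ, inner_sub_left, inner_add_left, real_inner_smul_left, inner_e_e])

/-- `R_θ e₀ = cos θ e₀ + sin θ e₁`. -/
theorem Rθ_e0 (θ : ℝ) : Rθ θ (EuclideanSpace.single 0 1) =
    Real.cos θ • EuclideanSpace.single 0 1 + Real.sin θ • EuclideanSpace.single 1 1 := by
  have h : Rθ θ (e 0) = uθ θ := by simp [Rθ, ρ₁_e0, ρθ_e0]
  simpa [e, uθ] using h

/-- `R_θ` fixes `e₂`. -/
theorem Rθ_e2 (θ : ℝ) : Rθ θ (EuclideanSpace.single 2 1) = EuclideanSpace.single 2 1 := by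
  simpa [e] using (show Rθ θ (e 2) = e 2 by simp [Rθ, ρ₁_e2, ρθ_e2])

/-- `R_θ` fixes `e₃`. -/
theorem Rθ_e3 (θ : ℝ) : Rθ θ (EuclideanSpace.single 3 1) = EuclideanSpace.single 3 1 := by
  simpa [e] using (show Rθ θ (e 3) = e 3 by simp [Rθ, ρ₁_e3, ρθ_e3])

/-- `R_θ` has determinant `1` (product of two hyperplane reflections), as soon as `cos θ ≠ 1`. -/
theorem Rθ_det {θ : ℝ} (hθ : Real.cos θ ≠ 1) :
    LinearMap.det ((Rθ θ).toLinearEquiv : E4 →ₗ[ℝ] E4) = 1 := by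
  have h1 : (e 1 - (-e 1) : E4) ≠ 0 := by
    intro h
    have := congrArg (fun v : E4 => v 1) h
    simp [e] at this
  have h2 : (e 0 - uθ θ : E4) ≠ 0 := by
    intro h
    have := congrArg (fun v : E4 => v 0) h
    simp [e, uθ_apply] at this
    exact hθ (by linarith)
  rw [Rθ, LinearIsometryEquiv.toLinearEquiv_trans, LinearEquiv.coe_trans, LinearMap.det_comp, ρ₁, ρθ,
    det_reflection_hyperplane h1, det_reflection_hyperplane h2]
  norm_num

/-- `R_θ` is "the planar rotation by `θ`" in the sense of the card. -/
theorem isPlanarRotation_Rθ {θ : ℝ} (hθ : Real.cos θ ≠ 1) : IsPlanarRotation (Rθ θ) θ :=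
  ⟨Rθ_det hθ, Rθ_e2 θ, Rθ_e3 θ, Rθ_e0 θ⟩

/-- The identity is "the planar rotation by `0`". -/
theorem isPlanarRotation_refl : IsPlanarRotation (LinearIsometryEquiv.refl ℝ E4) 0 := by
  refine ⟨?_, rfl, rfl, ?_⟩
  · have : ((LinearIsometryEquiv.refl ℝ E4).toLinearEquiv : E4 →ₗ[ℝ] E4) = LinearMap.id := rfl
    rw [this, LinearMap.det_id]
  · simp

/-! ## §2 The quarter-turn is a signed permutation -/

/-- A "planar rotation by `π/2`" permutes the axes up to sign (so the junk family is invariant). -/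
theorem isHyper_of_quarter {R : E4 ≃ₗᵢ[ℝ] E4} (hR : IsPlanarRotation R (Real.pi / 2)) : IsHyper R := by
  obtain ⟨-, h2, h3, h0⟩ := hR
  rw [Real.cos_pi_div_two, Real.sin_pi_div_two, zero_smul, one_smul, zero_add] at h0
  -- the image `v` of `e₁` is a unit vector orthogonal to `e₁, e₂, e₃`
  set v : E4 := R (EuclideanSpace.single 1 1) with hv
  have hv1 : v 1 = 0 := by
    rw [← inner_single_one, ← h0, hv, LinearIsometryEquiv.inner_map_map, inner_single_one]
    simp
  have hv2 : v 2 = 0 := by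
    rw [← inner_single_one, ← h2, hv, LinearIsometryEquiv.inner_map_map, inner_single_one]
    simp
  have hv3 : v 3 = 0 := by
    rw [← inner_single_one, ← h3, hv, LinearIsometryEquiv.inner_map_map, inner_single_one]
    simp
  have hnorm : ‖v‖ = 1 := by
    rw [hv, LinearIsometryEquiv.norm_map]
    simp [PiLp.norm_single]
  have hv0 : v 0 = 1 ∨ v 0 = -1 := by
    have h : ‖v‖ ^ 2 = 1 := by rw [hnorm]; norm_num
    rw [EuclideanSpace.norm_sq_eq] at h
    simp only [Fin.sum_univ_four, Real.norm_eq_abs, sq_abs, hv1, hv2, hv3] at h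
    have h' : (v 0 - 1) * (v 0 + 1) = 0 := by nlinarith
    rcases mul_eq_zero.1 h' with h'' | h''
    · left; linarith
    · right; linarith
  have hvec : v = (v 0) • EuclideanSpace.single 0 1 := by
    ext j
    fin_cases j <;> simp [hv1, hv2, hv3]
  intro i
  fin_cases i
  · exact ⟨1, Or.inl h0⟩
  · refine ⟨0, ?_⟩
    rcases hv0 with h | h
    · left
      change v = _
      rw [hvec, h, one_smul]
    · right
      change v = _
      rw [hvec, h, neg_one_smul]
  · exact ⟨2, Or.inl h2⟩
  · exact ⟨3, Or.inl h3⟩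

/-! ## §3 Geometric core: for `θ` away from the lattice angles no pattern fits the rotated bumps -/

/-- The rotated centres, for a frame `R e₀ = c e₀ + s e₁` fixing `e₂, e₃`. -/
theorem R_ctr (R : E4 ≃ₗᵢ[ℝ] E4) (c s : ℝ)
    (h0 : R (EuclideanSpace.single 0 1) = c • EuclideanSpace.single 0 1 + s • EuclideanSpace.single 1 1)
    (h2 : R (EuclideanSpace.single 2 1) = EuclideanSpace.single 2 1)
    (h3 : R (EuclideanSpace.single 3 1) = EuclideanSpace.single 3 1) (i : Fin 4) :
    R (ctr i) = (![0, (10 : ℝ) • e 3, (10 : ℝ) • e 2,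
      (10 : ℝ) • (c • EuclideanSpace.single 0 1 + s • EuclideanSpace.single 1 1)] : Fin 4 → E4) i := by
  fin_cases i <;> simp [ctr, e, h0, h2, h3]

/-- Coordinates `0` and `1` of `R (ctr j₀) - R (ctr i₀)` for the pair `(i₀, j₀)` used below. -/
theorem R_ctr_sub (R : E4 ≃ₗᵢ[ℝ] E4) (c s : ℝ)
    (h0 : R (EuclideanSpace.single 0 1) = c • EuclideanSpace.single 0 1 + s • EuclideanSpace.single 1 1)
    (h2 : R (EuclideanSpace.single 2 1) = EuclideanSpace.single 2 1)
    (h3 : R (EuclideanSpace.single 3 1) = EuclideanSpace.single 3 1) (i₀ : Fin 4) :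
    let j₀ : Fin 4 := if i₀ = 3 then 0 else 3
    |(R (ctr j₀)) 0 - (R (ctr i₀)) 0| = 10 * |c| ∧ |(R (ctr j₀)) 1 - (R (ctr i₀)) 1| = 10 * |s| := by
  intro j₀
  fin_cases i₀ <;> simp [j₀, R_ctr R c s h0 h2 h3, e, abs_mul]

/-- **Geometric core** (the disprover's `no_fit` for a general planar frame): if `10|c| ≥ 2` and
`10|s| ≥ 2`, no signed permutation of a pattern `A y ∘ π` is `R`-congruent to a bump-wise `1`-perturbation of
the centres. -/
theorem no_fit_R (R : E4 ≃ₗᵢ[ℝ] E4) (c s : ℝ)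
    (h0 : R (EuclideanSpace.single 0 1) = c • EuclideanSpace.single 0 1 + s • EuclideanSpace.single 1 1)
    (h2 : R (EuclideanSpace.single 2 1) = EuclideanSpace.single 2 1)
    (h3 : R (EuclideanSpace.single 3 1) = EuclideanSpace.single 3 1)
    (hc : 2 ≤ 10 * |c|) (hs : 2 ≤ 10 * |s|)
    (σ : Equiv.Perm (Fin 4)) (ε : Fin 4 → Bool) (π : Equiv.Perm (Fin 4)) (y : D7)
    (z : Fin 4 → E4) (hz : ∀ i, sp σ ε (A y (π i)) = R (z i))
    (hball : ∀ i, z i ∈ Metric.ball (ctr i) 1) : False := by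
  set i₀ : Fin 4 := π.symm 0 with hi₀
  have hπi₀ : π i₀ = 0 := by simp [hi₀]
  set j₀ : Fin 4 := if i₀ = 3 then 0 else 3 with hj₀def
  have hj₀ : j₀ ≠ i₀ := by
    by_cases h : i₀ = 3
    · rw [hj₀def, if_pos h, h]; decide
    · rw [hj₀def, if_neg h]; exact fun h' => h h'.symm
  have hk0 : π j₀ ≠ 0 := fun h => hj₀ (π.injective (h.trans hπi₀.symm))
  obtain ⟨a, m, ham⟩ := A_sub_axis y hk0
  -- the rotated difference is an axis vector
  have hw : R (z j₀ - z i₀) = (a * sgn (ε m)) • EuclideanSpace.single (σ m) 1 := by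
    rw [map_sub, ← hz j₀, ← hz i₀, hπi₀, ← map_sub, ham, LinearIsometryEquiv.map_smul, sp_single,
      mul_one]
    ext k; by_cases hk : k = σ m <;> simp [hk, mul_comm]
  -- it is within 2 of d = R (ctr j₀ - ctr i₀)
  have hd : ‖R (z j₀ - z i₀) - R (ctr j₀ - ctr i₀)‖ < 2 := by
    rw [← map_sub, LinearIsometryEquiv.norm_map]
    have h1 : ‖z j₀ - ctr j₀‖ < 1 := by simpa [dist_eq_norm] using hball j₀
    have h2 : ‖z i₀ - ctr i₀‖ < 1 := by simpa [dist_eq_norm] using hball i₀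
    calc ‖z j₀ - z i₀ - (ctr j₀ - ctr i₀)‖ = ‖(z j₀ - ctr j₀) - (z i₀ - ctr i₀)‖ := by
          congr 1; abel
      _ ≤ ‖z j₀ - ctr j₀‖ + ‖z i₀ - ctr i₀‖ := norm_sub_le _ _
      _ < 2 := by linarith
  obtain ⟨hd0, hd1⟩ := R_ctr_sub R c s h0 h2 h3 i₀
  rw [← hj₀def] at hd0 hd1
  have hcoord : ∀ ℓ : Fin 4, |(R (z j₀ - z i₀)) ℓ - ((R (ctr j₀)) ℓ - (R (ctr i₀)) ℓ)| < 2 := by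
    intro ℓ
    have h1 := PiLp.norm_apply_le (R (z j₀ - z i₀) - R (ctr j₀ - ctr i₀)) ℓ
    rw [Real.norm_eq_abs, PiLp.sub_apply] at h1
    have h2 := h1.trans_lt hd
    rwa [map_sub R (ctr j₀) (ctr i₀), PiLp.sub_apply] at h2
  rw [hw] at hcoord
  by_cases hm : σ m = 0
  · have h1 := hcoord 1
    have hne : (1 : Fin 4) ≠ σ m := by rw [hm]; decide
    simp only [PiLp.smul_apply, PiLp.single_apply, if_neg hne, smul_eq_mul, mul_zero, zero_sub,
      abs_neg] at h1
    linarith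
  · have h0' := hcoord 0
    have hne : (0 : Fin 4) ≠ σ m := fun h' => hm h'.symm
    simp only [PiLp.smul_apply, PiLp.single_apply, if_neg hne, smul_eq_mul, mul_zero, zero_sub,
      abs_neg] at h0'
    linarith

/-- `J (R · F₀) = 0` for every such frame. -/
theorem J_RF₀ (R : E4 ≃ₗᵢ[ℝ] E4) (c s : ℝ)
    (h0 : R (EuclideanSpace.single 0 1) = c • EuclideanSpace.single 0 1 + s • EuclideanSpace.single 1 1)
    (h2 : R (EuclideanSpace.single 2 1) = EuclideanSpace.single 2 1)
    (h3 : R (EuclideanSpace.single 3 1) = EuclideanSpace.single 3 1)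
    (hc : 2 ≤ 10 * |c|) (hs : 2 ≤ 10 * |s|) : J (linActMulti R F₀) = 0 := by
  rw [J_apply]
  refine Finset.sum_eq_zero fun g _ => Finset.sum_eq_zero fun π _ => ?_
  have hz : (fun y : D7 => (linActMulti R F₀) (fun i => sp g.1 g.2 (A y (π i)))) = fun _ => 0 := by
    funext y
    rw [linActMulti_apply, F₀_apply]
    by_contra hne
    have hne' : f₀ (fun i => R.symm (sp g.1 g.2 (A y (π i)))) ≠ 0 := by
      simpa using hne
    exact no_fit_R R c s h0 h2 h3 hc hs g.1 g.2 π y _ (fun i => by simp) (f₀_ball hne')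
  rw [hz]
  simp

/-- The angles `θ ∈ (1/2, 1)`: `10 cos θ ≥ 2`, `10 sin θ ≥ 2` and `cos θ ≠ 1`. -/
theorem angle_bounds {θ : ℝ} (h1 : 1 / 2 < θ) (h2 : θ < 1) :
    2 ≤ 10 * |Real.cos θ| ∧ 2 ≤ 10 * |Real.sin θ| ∧ Real.cos θ ≠ 1 := by
  have hcos : 1 / 2 ≤ Real.cos θ := by
    have := Real.one_sub_sq_div_two_le_cos (x := θ)
    nlinarith
  have hsin : 3 / 8 < Real.sin θ := by
    have h := Real.sin_gt_sub_cube (x := θ) (by linarith)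
    have hθ0 : 0 ≤ θ := by linarith
    have hsq : θ ^ 2 ≤ 1 := by nlinarith
    have h3 : θ ^ 3 ≤ θ := by
      have h4 := mul_le_mul_of_nonneg_left hsq hθ0
      calc θ ^ 3 = θ * θ ^ 2 := by ring
        _ ≤ θ * 1 := h4
        _ = θ := by ring
    linarith
  refine ⟨?_, ?_, ?_⟩
  · have : |Real.cos θ| = Real.cos θ := abs_of_nonneg (by linarith)
    rw [this]; linarith
  · have : |Real.sin θ| = Real.sin θ := abs_of_nonneg (by linarith)
    rw [this]; linarith
  · intro h
    have := Real.sin_sq_add_cos_sq θ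
    rw [h] at this
    nlinarith

/-- `𝔖₄ (R_θ · F₀) = 0` for `θ ∈ (1/2, 1)`. -/
theorem junk4_RθF₀ {θ : ℝ} (h1 : 1 / 2 < θ) (h2 : θ < 1) : junk 4 (linActMulti (Rθ θ) F₀) = 0 := by
  obtain ⟨hc, hs, -⟩ := angle_bounds h1 h2
  exact J_RF₀ (Rθ θ) _ _ (Rθ_e0 θ) (Rθ_e2 θ) (Rθ_e3 θ) hc hs

/-! ## §4 The refutation -/

/-- A finite exponential sum `Σ c_k e^{4ikθ}`, as an entire function of the complex angle. -/
def trigPoly (N : ℕ) (c : ℤ → ℂ) (w : ℂ) : ℂ :=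
  ∑ k ∈ Finset.Icc (-(N : ℤ)) N, c k * Complex.exp (4 * (k : ℂ) * w * Complex.I)

/-- It is complex-differentiable everywhere. -/
theorem differentiable_trigPoly (N : ℕ) (c : ℤ → ℂ) : Differentiable ℂ (trigPoly N c) := by
  unfold trigPoly
  fun_prop

/-- Its restriction to real angles is real-analytic. -/
theorem analyticOnNhd_trigPoly_real (N : ℕ) (c : ℤ → ℂ) :
    AnalyticOnNhd ℝ (trigPoly N c ∘ (Complex.ofRealCLM : ℝ → ℂ)) Set.univ := by
  intro t _
  have h1 : AnalyticAt ℂ (trigPoly N c) (Complex.ofRealCLM t) := (differentiable_trigPoly N c).analyticAt _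
  have h2 : AnalyticAt ℝ (trigPoly N c) (Complex.ofRealCLM t) := AnalyticAt.restrictScalars (𝕜 := ℝ) h1
  have h3 : AnalyticAt ℝ (Complex.ofRealCLM : ℝ → ℂ) t := Complex.ofRealCLM.analyticAt t
  exact h2.comp h3

/-- A finite exponential sum of real angle vanishing on `(1/2, 1)` vanishes at `0`. -/
theorem trigPoly_zero_of_vanish (N : ℕ) (c : ℤ → ℂ)
    (h : ∀ θ : ℝ, 1 / 2 < θ → θ < 1 → trigPoly N c (θ : ℂ) = 0) : trigPoly N c ((0 : ℝ) : ℂ) = 0 := by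
  set g : ℝ → ℂ := trigPoly N c ∘ (Complex.ofRealCLM : ℝ → ℂ) with hg
  have hga : AnalyticOnNhd ℝ g Set.univ := analyticOnNhd_trigPoly_real N c
  have hev : ∀ᶠ z in 𝓝[≠] (3 / 4 : ℝ), g z = 0 := by
    have hmem : Set.Ioo (1 / 2 : ℝ) 1 ∈ 𝓝 (3 / 4 : ℝ) := Ioo_mem_nhds (by norm_num) (by norm_num)
    have hev' : ∀ᶠ z in 𝓝 (3 / 4 : ℝ), g z = 0 :=
      Filter.mem_of_superset hmem fun z hz => by
        simp only [Set.mem_setOf_eq, hg, Function.comp_apply, Complex.ofRealCLM_apply]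
        exact h z hz.1 hz.2
    exact hev'.filter_mono nhdsWithin_le_nhds
  have hzero := hga.eqOn_zero_of_preconnected_of_frequently_eq_zero isPreconnected_univ
    (Set.mem_univ (3 / 4 : ℝ)) hev.frequently
  have h0 := hzero (Set.mem_univ (0 : ℝ))
  simpa [hg] using h0

/-- Pulling `F₀` back by the identity frame does nothing. -/
theorem junk4_refl_F₀ : junk 4 (linActMulti (LinearIsometryEquiv.refl ℝ E4) F₀) = junk 4 F₀ := by
  rw [linActMulti_refl, ContinuousLinearMap.id_apply]

set_option maxRecDepth 8000 in
set_option maxHeartbeats 1600000 in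
/-- **Theorem (crux-triage r1/3).** The first lemma `AngularBandLimit` of card `entire-angle-band-limit` is
false: witness = the landed junk family `junk` and the bump tensor `F₀`. (The raised recursion depth /
heartbeats only guard the comparison of two elaborations of `𝔖₄ (R · F₀)`, as in `ModelBlindFalse`.) -/
theorem not_AngularBandLimit : ¬ AngularBandLimit := by
  intro h
  have hquarter : ∀ (R : E4 ≃ₗᵢ[ℝ] E4), IsPlanarRotation R (Real.pi / 2) →
      ∀ (n : ℕ) (F : SchwartzMap (Fin n → E4) ℂ), IsOffDiagonal F →
        junk n (linActMulti R F) = junk n F :=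
    fun R hR n F _ => junk_hyper n (isHyper_of_quarter hR) F
  have hframes : EightFrameRP junk := fun R a b _ _ hR => junk_frame_rp R a b hR
  obtain ⟨C, hC⟩ := h junk junk_hasLinearGrowth junk_isSymmetric (fun n a F _ => junk_translate n a F)
    hquarter hframes
  obtain ⟨N, c, -, hT⟩ := hC 4 F₀ F₀_isOffDiagonal
  -- the angular function `θ ↦ 𝔖₄ (R_θ · F₀)` is the finite exponential sum `trigPoly N c`; it vanishes on `(1/2, 1)`
  have hvan : ∀ θ : ℝ, 1 / 2 < θ → θ < 1 → trigPoly N c (θ : ℂ) = 0 := by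
    intro θ h1 h2
    obtain ⟨-, -, hne⟩ := angle_bounds h1 h2
    have h3 : junk 4 (linActMulti (Rθ θ) F₀) = trigPoly N c (θ : ℂ) := hT (Rθ θ) θ (isPlanarRotation_Rθ hne)
    exact h3.symm.trans (junk4_RθF₀ h1 h2)
  -- ... hence at `0`, where it is `𝔖₄ (F₀)`, which has positive real part
  have h0 : junk 4 F₀ = 0 := by
    have h1 : junk 4 (linActMulti (LinearIsometryEquiv.refl ℝ E4) F₀) = trigPoly N c ((0 : ℝ) : ℂ) :=
      hT (LinearIsometryEquiv.refl ℝ E4) 0 isPlanarRotation_refl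
    exact junk4_refl_F₀.symm.trans (h1.trans (trigPoly_zero_of_vanish N c hvan))
  have := junk4_F₀_re_pos
  rw [h0, Complex.zero_re] at this
  exact lt_irrefl _ this

end Summit.QuantumFields.YangMills.Theorems.NPointIsotropy.Negative.Triage3

end
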